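import Summits.QuantumFields.YangMills.Theorems.CovariantDischargeSandwichFractionalOfCapped
import Summits.QuantumFields.YangMills.Theorems.CovariantDischargeSandwichSweepGapCapped
import HarnessLib

/-!
# Crux `HistoryTailL` (stmt-QuantumFields-19936) — THE SANDWICH FACE, ONE ROW: `HistoryTailL ⟸ SandwichDeepWindowTailL`

Cell `ym3-torus` (YM ladder rung R3 = continuum SU(2) Yang–Mills on every three-torus — a RECORD rung, NOT the Clay problem), width seat
`ym-ust-19936-w5` gen 15.  Ideator line «sandwich_discharge» (LINE 24 «SeveritySandwich», route-QuantumFields-CovariantDischarge rev 3; registered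
skeleton v5 `Cruxes/HistoryTailL/Lines/sandwich_discharge.lean` sha16 `470b3af6f9aa04e1`).

THE EVENT.  The load-bearing registered stub `stub_sandwichSweepGapCapped` is a tree theorem (✓p729233
`CovariantDischargeSandwichSweepGapCapped.stub_sandwichSweepGapCapped`, seat px8 g8 and the B6-door company), so the two-row sandwich face
✓p728315 `CovariantDischargeSandwichFractionalOfCapped.historyTailL_of_capped_of_deep (hCap) (hDeep)` loses its `hCap` row BY NAME.  What is
displayed here is the registered v5 composition with THREE of its four stubs folded (✓p708497 Large, ✓p710808 LargeBase, ✓p729233 Capped):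

  `historyTailL_of_sandwichDeep : Theses.CovariantDischarge.SandwichDeepWindowTailL → Theses.UnitScaleTilt.HistoryTailL`.

The one remaining row IS the route's residual item `SandwichDeepWindowTailL` (stmt-QuantumFields-24187, organ-class: the same sandwich bound at the
DEEP constrained heights `j + n ≤ K < N₁·j + n`, i.e. cut-off-uniform integration at depth Θ(K) = Bałaban's unprinted large-field induction
[Balaban1989LargeFieldII, Thm 1 p.358] — «nobody is asked to prove it on this route»).  This is the sandwich lane's honest residue, exactly parallel
to the Poincaré–Lipschitz face of record (✓p725845 `PoincareLipschitzHistoryTailOfFacts.historyTailL_of_facts`: {K1-exp, (C), (RS), MeanDeviationL}).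

WHAT THIS IS NOT.  A one-line composition; CONDITIONAL on `SandwichDeepWindowTailL`, which is NOT proved; `HistoryTailL` is NOT proved; rung R3
is a record rung — NOT d = 4, NOT infinite volume, NOT a mass gap, NOT the Clay problem.

References: T. Bałaban, CMP **102** (1985) 255–275 [Balaban1985UV3] ((7) p.257, (71) p.273); T. Bałaban, CMP **122** (1989) 355–392
[Balaban1989LargeFieldII] (Thm 1 p.358).
-/

noncomputable section

namespace Summit.QuantumFields.YangMills.Theorems

namespace CovariantDischargeHistoryTailOfSandwichDeep

/-- **THE SANDWICH FACE OF `HistoryTailL`, ONE ROW.**  The route's residual `SandwichDeepWindowTailL` (stmt-QuantumFields-24187, organ-class)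
ALONE gives the shared crux `UnitScaleTilt.HistoryTailL` (stmt-QuantumFields-19936): the registered v5 composition with its three landed stubs folded
BY NAME — ✓p729233 `stub_sandwichSweepGapCapped` into ✓p728315 `historyTailL_of_capped_of_deep` (which already folds ✓p708497, ✓p710808, the
bounded-depth rung ✓p706476 and the door ✓p705200).  CONDITIONAL: the hypothesis is Bałaban's unprinted large-field induction at depth Θ(K);
nothing is proved about it here. [cite: Balaban1985UV3, (7) p.257 and (71) p.273; Balaban1989LargeFieldII, Thm 1 p.358] -/
theorem historyTailL_of_sandwichDeep
    (hDeep : Summit.QuantumFields.YangMills.Theses.CovariantDischarge.SandwichDeepWindowTailL) :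
    Summit.QuantumFields.YangMills.Theses.UnitScaleTilt.HistoryTailL :=
  CovariantDischargeSandwichFractionalOfCapped.historyTailL_of_capped_of_deep
    CovariantDischargeSandwichSweepGapCapped.stub_sandwichSweepGapCapped hDeep

end CovariantDischargeHistoryTailOfSandwichDeep

end Summit.QuantumFields.YangMills.Theorems

end
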